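import Mathlib
import HarnessLib

/-!
# The univariate interval Newton operator `N(X) = m(X) − f(m(X)) / F'(X)`: enclosure of zeros,
# exclusion, uniqueness, Hansen's existence test `N(X) ⊆ X`, and the halving property

Topic `Literature/Analysis/ValidatedNumerics`.  Everything here is PROVED; no named fact, no axiom.

For a single real equation `f(x) = 0` on an interval `X = [a, b]` Moore [Moore1979, §5.2,
(5.14)–(5.16)] uses, instead of the Krawczyk operator, the simpler INTERVAL NEWTON OPERATOR
`N(X) := m − f(m) / F'(X)` (`m = m(X)` a point of `X`, `F'(X)` an interval enclosing `f'` on `X` with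
`0 ∉ F'(X)`), and the iteration `X⁽ᵏ⁺¹⁾ := X⁽ᵏ⁾ ∩ N(X⁽ᵏ⁾)` (5.16).  We record the operator as the exact
range `newtonSet m (f m) D = {m − f(m)/d : d ∈ D}` over an arbitrary derivative enclosure `D ⊆ ℝ`
(for an interval `D = [d̲, d̄]` not containing `0` this is the interval `m − f(m)·[1/d̄, 1/d̲]` of the
book) and prove the four soundness statements every univariate interval-Newton root isolator relies on:

* `zero_mem_newtonSet` — Moore's derivation (5.14)–(5.15) and the first assertion of
  [Moore1979, §5.2 Thm 5.5]: if `f` is differentiable on `[a, b]` with `f'(x) ∈ D` there, `0 ∉ D`,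
  `m ∈ [a, b]`, then EVERY zero `x ∈ [a, b]` of `f` lies in `N = newtonSet m (f m) D` (mean value
  theorem: `f(m) = f(m) − f(x) = f'(s)(m − x)`, so `x = m − f(m)/f'(s)`); hence every zero of `f` in
  `X⁽⁰⁾` lies in all iterates of (5.16) (`zero_mem_inter_newtonSet`);
* `forall_ne_zero_of_disjoint_newtonSet` — the EXCLUSION test: `N ∩ X = ∅` ⇒ `f` has no zero in `X`
  (the sentence before Thm 5.6: "we can tell from an empty intersection `X ∩ N(X)` that there is no
  zero in `X`");
* `zero_unique_of_deriv_enclosure` — `0 ∉ D` ⇒ `f` has AT MOST ONE zero in `X` (Rolle);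
* `exists_zero_of_newtonSet_subset` — the EXISTENCE test [Moore1979, §5.2 Thm 5.6; Moore gives no
  proof and refers to E. Hansen (his note N 13); cf. Hansen1978 on interval forms of Newton's method]:
  `D = [d̲, d̄]` with `0 ∉ D`, `m ∈ X` and `N(X) ⊆ X` ⇒ `f` HAS a zero in `X`; with the two previous
  items, exactly one, and it lies in `N(X)` (`existsUnique_zero_of_newtonSet_subset`).  The proof
  typed here is the elementary sign argument (ours; the statement is Moore's verbatim): say
  `d̲ > 0`; if `f(m) ≥ 0` the point `m − f(m)/d̲ ∈ N ⊆ X` gives `f(m) ≤ d̲ (m − a)`, and the mean value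
  theorem gives `f(m) − f(a) ≥ d̲ (m − a)`, so `f(a) ≤ 0 ≤ f(m)` and the intermediate value theorem
  yields a zero in `[a, m]`; `f(m) < 0` is symmetric on `[m, b]`; `d̄ < 0` reduces to `−f`;
* `newtonSet_subset_Iio_or_Ioi` / `abs_sub_le_half_of_mem_inter_newtonSet` — the HALVING property in
  the proof of [Moore1979, §5.2 Thm 5.5]: if `0 ∉ D = [d̲, d̄]` and `f(m) ≠ 0` then `m ∉ N(X)`, indeed
  `N(X)` lies entirely on one side of `m`, so for the midpoint `m = (a + b)/2` any two points of
  `X ∩ N(X)` are within `(b − a)/2` of each other ("`w(X⁽ᵏ⁺¹⁾) < ½ w(X⁽ᵏ⁾)`"; if `f(m) = 0` then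
  `N(X) = {m}`, `newtonSet_of_eq_zero`).

A worked instance closes the file (`sqrtTwo_test`): `f(x) = x² − 2` on `X = [1, 2]`, `m = 3/2`,
`F'(X) = 2·X = [2, 4]`: `N(X) = 3/2 − (1/4)·[1/4, 1/2] = [11/8, 23/16] ⊆ X`, so `x² = 2` has exactly
one solution in `[1, 2]` and it lies in `[1.375, 1.4375]` — the first step of (5.16) for `√2`.

Motivation and first use: this is the soundness content of univariate interval-Newton root
bracketing as run by the H21 engines group's `cap` kernels (root isolation / refinement of scalar
equations before a Krawczyk or Taylor-model certificate takes over).  Shared numerical engines serve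
client cells; rigour lives in the verifiers; nothing in this file is a claim about any engine output —
it states what a successful run of such a test proves.

NOT here: the `n`-dimensional operators (Krawczyk: `KrawczykOperator.lean`, `KrawczykOperatorHolds.lean`,
`KrawczykIterationConvergence.lean`; Hansen–Sengupta: `HansenSenguptaOperator.lean`); extended
interval division when `0 ∈ F'(X)` ((5.17): the union of two unbounded intervals); floating-point
rounding of `m − f(m)/F'(X)` (any machine enclosure `N̂ ⊇ N` inherits enclosure and exclusion by
monotonicity, `zero_mem_of_newtonSet_subset`; the existence test must then be applied to `N̂ ⊆ X`, which
implies `N ⊆ X`).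

## References

* R. E. Moore, *Methods and Applications of Interval Analysis*, SIAM Studies in Applied Mathematics 2
  (1979), §5.2, eqs. (5.14)–(5.16), Theorem 5.5, Theorem 5.6. [cite: Moore1979, §5.2 (5.14)–(5.16), Thm 5.5, Thm 5.6]
* E. R. Hansen, Interval forms of Newton's method, *Computing* 20 (1978) 153–163 (interval Newton
  operators and their existence tests; Moore's Thm 5.6 defers its proof to Hansen, note N 13).
  [cite: Hansen1978]
-/

open Set

namespace Literature.Analysis.ValidatedNumerics.IntervalNewton

/-! ### The operator -/

/-- The univariate interval Newton image `N = m − f(m)/D` as the exact range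
`{m − fm / d : d ∈ D}` over a derivative enclosure `D` [cite: Moore1979, §5.2 (5.16)]. -/
def newtonSet (m fm : ℝ) (D : Set ℝ) : Set ℝ := (fun d : ℝ => m - fm / d) '' D

/-- Membership in the Newton image: `x = m − fm/d` for some `d ∈ D` [cite: Moore1979, §5.2 (5.15)–(5.16)]. -/
theorem mem_newtonSet {m fm : ℝ} {D : Set ℝ} {x : ℝ} :
    x ∈ newtonSet m fm D ↔ ∃ d ∈ D, m - fm / d = x := by
  simp [newtonSet]

/-- The Newton image is inclusion monotone in the derivative enclosure `D` (a wider `F'(X)` gives a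
wider `N(X)`) [cite: Moore1979, §5.2 (5.16)]. -/
theorem newtonSet_mono {m fm : ℝ} {D D' : Set ℝ} (h : D ⊆ D') :
    newtonSet m fm D ⊆ newtonSet m fm D' :=
  image_mono h

/-- If `f(m) = 0` the Newton image collapses to the point `m` (for nonempty `D`)
[cite: Moore1979, §5.2 Thm 5.5 (proof)]. -/
theorem newtonSet_of_eq_zero {m : ℝ} {D : Set ℝ} (hD : D.Nonempty) :
    newtonSet m 0 D = {m} := by
  ext x
  simp only [mem_newtonSet, zero_div, sub_zero, mem_singleton_iff]
  constructor
  · rintro ⟨d, -, rfl⟩; rfl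
  · rintro rfl; obtain ⟨d, hd⟩ := hD; exact ⟨d, hd, rfl⟩

/-- For an interval enclosure `D = [dl, du]` with `0 < dl` and `fm ≥ 0`, the Newton image is the
interval `[m − fm/dl, m − fm/du]` — the book's `m − f(m)·[1/d̄, 1/d̲]` [cite: Moore1979, §5.2 (5.16)]. -/
theorem newtonSet_Icc_of_pos_of_nonneg {m fm dl du : ℝ} (hdl : 0 < dl) (hle : dl ≤ du) (hfm : 0 ≤ fm) :
    newtonSet m fm (Icc dl du) = Icc (m - fm / dl) (m - fm / du) := by
  have hdu : 0 < du := lt_of_lt_of_le hdl hle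
  ext x
  simp only [mem_newtonSet, mem_Icc]
  constructor
  · rintro ⟨d, ⟨h1, h2⟩, rfl⟩
    have hd : 0 < d := lt_of_lt_of_le hdl h1
    constructor
    · have : fm / d ≤ fm / dl := div_le_div_of_nonneg_left hfm hdl h1
      linarith
    · have : fm / du ≤ fm / d := div_le_div_of_nonneg_left hfm hd h2
      linarith
  · rintro ⟨h1, h2⟩
    -- the value m - x lies in [fm/du, fm/dl]; pick d := fm / (m - x) when m ≠ x
    by_cases hfm0 : fm = 0
    · subst hfm0
      simp only [zero_div, sub_zero] at h1 h2
      exact ⟨dl, ⟨le_rfl, hle⟩, by simp; linarith⟩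
    have hfm' : 0 < fm := lt_of_le_of_ne hfm (Ne.symm hfm0)
    have hmx : 0 < m - x := by
      have : 0 < fm / du := div_pos hfm' hdu
      linarith
    refine ⟨fm / (m - x), ⟨?_, ?_⟩, ?_⟩
    · -- dl ≤ fm/(m-x)  ⇔  dl (m - x) ≤ fm  ⇐  m - x ≤ fm/dl
      rw [le_div_iff₀ hmx]
      have : m - x ≤ fm / dl := by linarith
      calc dl * (m - x) ≤ dl * (fm / dl) := by exact mul_le_mul_of_nonneg_left this hdl.le
        _ = fm := by field_simp
    · rw [div_le_iff₀ hmx]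
      have : fm / du ≤ m - x := by linarith
      calc fm = du * (fm / du) := by field_simp
        _ ≤ du * (m - x) := mul_le_mul_of_nonneg_left this hdu.le
    · have : fm / (fm / (m - x)) = m - x := by field_simp
      rw [this]; ring

/-! ### Enclosure of zeros and the exclusion test -/

section Enclosure

variable {f f' : ℝ → ℝ} {a b m : ℝ} {D : Set ℝ}

/-- **Every zero of `f` in `X` lies in `N(X)`** — the derivation (5.14)–(5.15) and the first assertion
of [cite: Moore1979, §5.2 Thm 5.5]: `f` differentiable on `X = [a, b]` with derivative values in `D`,
`0 ∉ D`, `m ∈ X`; then `f x = 0`, `x ∈ X` imply `x ∈ newtonSet m (f m) D`. -/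
theorem zero_mem_newtonSet (hf : ∀ x ∈ Icc a b, HasDerivAt f (f' x) x)
    (hD : ∀ x ∈ Icc a b, f' x ∈ D) (h0 : (0 : ℝ) ∉ D) (hm : m ∈ Icc a b)
    {x : ℝ} (hx : x ∈ Icc a b) (hfx : f x = 0) : x ∈ newtonSet m (f m) D := by
  rw [mem_newtonSet]
  rcases lt_trichotomy x m with hlt | heq | hgt
  · -- x < m : MVT on [x, m]
    have hsub : Icc x m ⊆ Icc a b := Icc_subset_Icc hx.1 hm.2
    have hcont : ContinuousOn f (Icc x m) := fun y hy =>
      (hf y (hsub hy)).continuousAt.continuousWithinAt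
    have hder : ∀ y ∈ Ioo x m, HasDerivAt f (f' y) y := fun y hy =>
      hf y (hsub (Ioo_subset_Icc_self hy))
    obtain ⟨s, hs, hslope⟩ := exists_hasDerivAt_eq_slope f f' hlt hcont hder
    have hsD : f' s ∈ D := hD s (hsub (Ioo_subset_Icc_self hs))
    have hs0 : f' s ≠ 0 := fun h => h0 (h ▸ hsD)
    refine ⟨f' s, hsD, ?_⟩
    have hne : m - x ≠ 0 := sub_ne_zero.mpr (ne_of_gt hlt)
    have : f' s * (m - x) = f m := by
      rw [hslope, hfx, sub_zero, div_mul_cancel₀ _ hne]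
    rw [← this]; field_simp; ring
  · subst heq
    have hxD : f' x ∈ D := hD x hx
    exact ⟨f' x, hxD, by simp [hfx]⟩
  · -- m < x : MVT on [m, x]
    have hsub : Icc m x ⊆ Icc a b := Icc_subset_Icc hm.1 hx.2
    have hcont : ContinuousOn f (Icc m x) := fun y hy =>
      (hf y (hsub hy)).continuousAt.continuousWithinAt
    have hder : ∀ y ∈ Ioo m x, HasDerivAt f (f' y) y := fun y hy =>
      hf y (hsub (Ioo_subset_Icc_self hy))
    obtain ⟨s, hs, hslope⟩ := exists_hasDerivAt_eq_slope f f' hgt hcont hder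
    have hsD : f' s ∈ D := hD s (hsub (Ioo_subset_Icc_self hs))
    have hs0 : f' s ≠ 0 := fun h => h0 (h ▸ hsD)
    refine ⟨f' s, hsD, ?_⟩
    have hne : x - m ≠ 0 := sub_ne_zero.mpr (ne_of_gt hgt)
    have : f' s * (x - m) = - f m := by
      rw [hslope, hfx, zero_sub, div_mul_cancel₀ _ hne]
    have h2 : f m = - (f' s * (x - m)) := by rw [this]; ring
    rw [h2]; field_simp; ring

/-- Zeros survive the intersection step `X ∩ N(X)` of the iteration (5.16)
[cite: Moore1979, §5.2 Thm 5.5]. -/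
theorem zero_mem_inter_newtonSet (hf : ∀ x ∈ Icc a b, HasDerivAt f (f' x) x)
    (hD : ∀ x ∈ Icc a b, f' x ∈ D) (h0 : (0 : ℝ) ∉ D) (hm : m ∈ Icc a b)
    {x : ℝ} (hx : x ∈ Icc a b) (hfx : f x = 0) : x ∈ Icc a b ∩ newtonSet m (f m) D :=
  ⟨hx, zero_mem_newtonSet hf hD h0 hm hx hfx⟩

/-- Any OUTER enclosure `N' ⊇ N(X)` (e.g. a machine-rounded evaluation of `m − f(m)/F'(X)`) still
contains every zero of `f` in `X` [cite: Moore1979, §5.2 Thm 5.5]. -/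
theorem zero_mem_of_newtonSet_subset (hf : ∀ x ∈ Icc a b, HasDerivAt f (f' x) x)
    (hD : ∀ x ∈ Icc a b, f' x ∈ D) (h0 : (0 : ℝ) ∉ D) (hm : m ∈ Icc a b)
    {N' : Set ℝ} (hN' : newtonSet m (f m) D ⊆ N')
    {x : ℝ} (hx : x ∈ Icc a b) (hfx : f x = 0) : x ∈ N' :=
  hN' (zero_mem_newtonSet hf hD h0 hm hx hfx)

/-- **Exclusion test**: if `N(X)` (or any enclosure of it) does not meet `X`, then `f` has no zero in `X`
[cite: Moore1979, §5.2 (sentence before Thm 5.6)]. -/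
theorem forall_ne_zero_of_disjoint_newtonSet (hf : ∀ x ∈ Icc a b, HasDerivAt f (f' x) x)
    (hD : ∀ x ∈ Icc a b, f' x ∈ D) (h0 : (0 : ℝ) ∉ D) (hm : m ∈ Icc a b)
    {N' : Set ℝ} (hN' : newtonSet m (f m) D ⊆ N') (hdis : Disjoint (Icc a b) N') :
    ∀ x ∈ Icc a b, f x ≠ 0 := fun _ hx hfx =>
  (Set.disjoint_left.mp hdis) hx (hN' (zero_mem_newtonSet hf hD h0 hm hx hfx))

/-- **Uniqueness**: with a derivative enclosure `D ∌ 0` on `X`, `f` has at most one zero in `X`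
(Rolle; the uniqueness half of [cite: Moore1979, §5.2 Thm 5.5–5.6]). -/
theorem zero_unique_of_deriv_enclosure (hf : ∀ x ∈ Icc a b, HasDerivAt f (f' x) x)
    (hD : ∀ x ∈ Icc a b, f' x ∈ D) (h0 : (0 : ℝ) ∉ D)
    {x y : ℝ} (hx : x ∈ Icc a b) (hy : y ∈ Icc a b) (hfx : f x = 0) (hfy : f y = 0) : x = y := by
  by_contra hne
  wlog hlt : x < y generalizing x y
  · exact this hy hx hfy hfx (Ne.symm hne) (lt_of_le_of_ne (not_lt.mp hlt) (Ne.symm hne))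
  have hsub : Icc x y ⊆ Icc a b := Icc_subset_Icc hx.1 hy.2
  have hcont : ContinuousOn f (Icc x y) := fun z hz =>
    (hf z (hsub hz)).continuousAt.continuousWithinAt
  have hder : ∀ z ∈ Ioo x y, HasDerivAt f (f' z) z := fun z hz =>
    hf z (hsub (Ioo_subset_Icc_self hz))
  obtain ⟨s, hs, hslope⟩ := exists_hasDerivAt_eq_slope f f' hlt hcont hder
  have : f' s = 0 := by rw [hslope, hfx, hfy]; simp
  exact h0 (this ▸ hD s (hsub (Ioo_subset_Icc_self hs)))

end Enclosure

/-! ### Hansen's existence test `N(X) ⊆ X` -/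

section Existence

variable {f f' : ℝ → ℝ} {a b m dl du : ℝ}

/-- The case `0 < d̲` (increasing `f`) of the existence test [cite: Moore1979, §5.2 Thm 5.6]
(cf. [cite: Hansen1978]): `N(X) ⊆ X` ⇒ a zero in `X`, by the sign argument `f(a) ≤ 0 ≤ f(m)` or
`f(m) ≤ 0 ≤ f(b)` and the intermediate value theorem. -/
theorem exists_zero_of_newtonSet_subset_of_pos (hf : ∀ x ∈ Icc a b, HasDerivAt f (f' x) x)
    (hD : ∀ x ∈ Icc a b, f' x ∈ Icc dl du) (hdl : 0 < dl) (hm : m ∈ Icc a b)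
    (hN : newtonSet m (f m) (Icc dl du) ⊆ Icc a b) : ∃ x ∈ Icc a b, f x = 0 := by
  have hle : dl ≤ du := (hD m hm).1.trans (hD m hm).2
  have hcontab : ContinuousOn f (Icc a b) := fun y hy => (hf y hy).continuousAt.continuousWithinAt
  -- the point m - f m / dl belongs to N ⊆ [a, b]
  have hp : m - f m / dl ∈ Icc a b := hN ⟨dl, ⟨le_rfl, hle⟩, rfl⟩
  -- MVT lower bound: f v - f u ≥ dl (v - u) on [a, b]
  have hmvt : ∀ u ∈ Icc a b, ∀ v ∈ Icc a b, u < v → dl * (v - u) ≤ f v - f u := by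
    intro u hu v hv huv
    have hsub : Icc u v ⊆ Icc a b := Icc_subset_Icc hu.1 hv.2
    obtain ⟨s, hs, hslope⟩ := exists_hasDerivAt_eq_slope f f' huv (hcontab.mono hsub)
      (fun z hz => hf z (hsub (Ioo_subset_Icc_self hz)))
    have hs1 : dl ≤ f' s := (hD s (hsub (Ioo_subset_Icc_self hs))).1
    have hpos : 0 < v - u := sub_pos.mpr huv
    have := mul_le_mul_of_nonneg_right hs1 hpos.le
    rwa [hslope, div_mul_cancel₀ _ (ne_of_gt hpos)] at this
  rcases le_or_gt 0 (f m) with hfm | hfm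
  · -- f m ≥ 0 : zero in [a, m]
    rcases eq_or_lt_of_le hm.1 with hma | hma
    · -- a = m : then f m / dl ≤ 0 forces f m = 0
      have h := hp.1
      rw [hma] at h
      have h' : f m / dl ≤ 0 := by linarith
      have hfm0' : f m ≤ 0 := by
        have := (div_le_iff₀ hdl).mp h'
        simpa using this
      exact ⟨m, hm, le_antisymm hfm0' hfm⟩
    · have h1 : dl * (m - a) ≤ f m - f a := hmvt a ⟨le_rfl, hm.1.trans hm.2⟩ m hm hma
      have h2 : f m ≤ dl * (m - a) := by
        have : f m / dl ≤ m - a := by linarith [hp.1]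
        calc f m = dl * (f m / dl) := by field_simp
          _ ≤ dl * (m - a) := mul_le_mul_of_nonneg_left this hdl.le
      have hfa : f a ≤ 0 := by linarith
      have hIVT := intermediate_value_Icc hm.1 (hcontab.mono (Icc_subset_Icc le_rfl hm.2))
      obtain ⟨x, hx, hx0⟩ := hIVT ⟨hfa, hfm⟩
      exact ⟨x, ⟨hx.1, hx.2.trans hm.2⟩, hx0⟩
  · -- f m < 0 : zero in [m, b]
    rcases eq_or_lt_of_le hm.2 with hmb | hmb
    · -- m = b : then m - f m / dl ≤ b = m forces - f m / dl ≤ 0, contradiction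
      have : 0 < -(f m) / dl := div_pos (neg_pos.mpr hfm) hdl
      have h' := hp.2
      rw [hmb] at h' hfm this
      have : -(f b) / dl = - (f b / dl) := by ring
      linarith
    · have h1 : dl * (b - m) ≤ f b - f m := hmvt m hm b ⟨hm.1.trans hm.2, le_rfl⟩ hmb
      have h2 : -(f m) ≤ dl * (b - m) := by
        have : -(f m) / dl ≤ b - m := by
          have := hp.2
          have e : -(f m) / dl = -(f m / dl) := by ring
          linarith
        calc -(f m) = dl * (-(f m) / dl) := by field_simp
          _ ≤ dl * (b - m) := mul_le_mul_of_nonneg_left this hdl.le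
      have hfb : 0 ≤ f b := by linarith
      have hIVT := intermediate_value_Icc hm.2 (hcontab.mono (Icc_subset_Icc hm.1 le_rfl))
      obtain ⟨x, hx, hx0⟩ := hIVT ⟨hfm.le, hfb⟩
      exact ⟨x, ⟨hm.1.trans hx.1, hx.2⟩, hx0⟩

/-- The Newton image is invariant under `(f, D) ↦ (−f, −D)` (elementary; private plumbing) [folklore]. -/
private theorem newtonSet_neg (m fm : ℝ) (D : Set ℝ) :
    newtonSet m (-fm) ((fun d => -d) '' D) = newtonSet m fm D := by
  ext x
  simp only [mem_newtonSet, mem_image, exists_exists_and_eq_and]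
  constructor
  · rintro ⟨d, hd, rfl⟩; exact ⟨d, hd, by rw [neg_div_neg_eq]⟩
  · rintro ⟨d, hd, rfl⟩; exact ⟨d, hd, by rw [neg_div_neg_eq]⟩

/-- `-(Icc dl du) = Icc (-du) (-dl)` for the lambda spelling of negation (Mathlib `Set.image_neg_Icc`;
private plumbing) [folklore]. -/
private theorem image_neg_Icc' (dl du : ℝ) : (fun d : ℝ => -d) '' Icc dl du = Icc (-du) (-dl) := by
  have : (fun d : ℝ => -d) = Neg.neg := rfl
  rw [this, image_neg_Icc]

/-- **Existence test** [cite: Moore1979, §5.2 Thm 5.6] (Moore defers the proof to E. Hansen, note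
N 13; cf. [cite: Hansen1978]): if `f` is differentiable on `X = [a, b]` with `f'(x) ∈ D = [d̲, d̄]`,
`0 ∉ D`, `m ∈ X` and `N(X) = m − f(m)/D ⊆ X`, then `f` has a zero in `X`. -/
theorem exists_zero_of_newtonSet_subset (hf : ∀ x ∈ Icc a b, HasDerivAt f (f' x) x)
    (hD : ∀ x ∈ Icc a b, f' x ∈ Icc dl du) (h0 : (0 : ℝ) ∉ Icc dl du) (hm : m ∈ Icc a b)
    (hN : newtonSet m (f m) (Icc dl du) ⊆ Icc a b) : ∃ x ∈ Icc a b, f x = 0 := by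
  have hle : dl ≤ du := (hD m hm).1.trans (hD m hm).2
  -- 0 ∉ [dl, du] with dl ≤ du: either 0 < dl or du < 0
  rcases lt_or_ge 0 dl with hdl | hdl
  · exact exists_zero_of_newtonSet_subset_of_pos hf hD hdl hm hN
  · have hdu : du < 0 := by
      by_contra h; exact h0 ⟨hdl, not_lt.mp h⟩
    -- apply the positive case to -f with enclosure [-du, -dl]
    have hf' : ∀ x ∈ Icc a b, HasDerivAt (fun y => -f y) (-f' x) x := fun x hx => (hf x hx).neg
    have hD' : ∀ x ∈ Icc a b, -f' x ∈ Icc (-du) (-dl) := fun x hx =>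
      ⟨neg_le_neg (hD x hx).2, neg_le_neg (hD x hx).1⟩
    have hN' : newtonSet m (-f m) (Icc (-du) (-dl)) ⊆ Icc a b := by
      rw [← image_neg_Icc', newtonSet_neg]; exact hN
    obtain ⟨x, hx, hx0⟩ :=
      exists_zero_of_newtonSet_subset_of_pos (f := fun y => -f y) hf' hD' (neg_pos.mpr hdu) hm hN'
    exact ⟨x, hx, neg_eq_zero.mp hx0⟩

/-- **The complete univariate interval Newton test**: under the hypotheses of the existence test,
`f` has EXACTLY ONE zero in `X`, and that zero lies in `N(X)`
[cite: Moore1979, §5.2 Thm 5.5, Thm 5.6]. -/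
theorem existsUnique_zero_of_newtonSet_subset (hf : ∀ x ∈ Icc a b, HasDerivAt f (f' x) x)
    (hD : ∀ x ∈ Icc a b, f' x ∈ Icc dl du) (h0 : (0 : ℝ) ∉ Icc dl du) (hm : m ∈ Icc a b)
    (hN : newtonSet m (f m) (Icc dl du) ⊆ Icc a b) :
    (∃! x, x ∈ Icc a b ∧ f x = 0) ∧ ∀ x ∈ Icc a b, f x = 0 → x ∈ newtonSet m (f m) (Icc dl du) := by
  obtain ⟨x, hx, hx0⟩ := exists_zero_of_newtonSet_subset hf hD h0 hm hN
  refine ⟨⟨x, ⟨hx, hx0⟩, fun y hy => zero_unique_of_deriv_enclosure hf hD h0 hy.1 hx hy.2 hx0⟩, ?_⟩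
  exact fun z hz hz0 => zero_mem_newtonSet hf hD h0 hm hz hz0

end Existence

/-! ### The halving property (proof of Thm 5.5) -/

section Halving

variable {m fm dl du : ℝ}

/-- If `0 ∉ D = [d̲, d̄]` and `f(m) ≠ 0`, the Newton image lies strictly on one side of `m`; in
particular `m ∉ N(X)` [cite: Moore1979, §5.2 Thm 5.5 (proof)]. -/
theorem newtonSet_subset_Iio_or_Ioi (h0 : (0 : ℝ) ∉ Icc dl du) (hfm : fm ≠ 0) :
    newtonSet m fm (Icc dl du) ⊆ Iio m ∨ newtonSet m fm (Icc dl du) ⊆ Ioi m := by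
  -- sign of fm / d is constant for d ∈ D
  rcases lt_or_ge 0 dl with hdl | hdl
  · rcases lt_or_gt_of_ne hfm with hneg | hpos
    · right; rintro x ⟨d, hd, rfl⟩
      have hd0 : 0 < d := lt_of_lt_of_le hdl hd.1
      have : fm / d < 0 := div_neg_of_neg_of_pos hneg hd0
      simp only [mem_Ioi]; linarith
    · left; rintro x ⟨d, hd, rfl⟩
      have hd0 : 0 < d := lt_of_lt_of_le hdl hd.1
      have : 0 < fm / d := div_pos hpos hd0
      simp only [mem_Iio]; linarith
  · rcases lt_or_gt_of_ne hfm with hneg | hpos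
    · left; rintro x ⟨d, hd, rfl⟩
      have hd0 : d < 0 := by
        rcases lt_or_ge d 0 with h | h
        · exact h
        · exact absurd (show (0 : ℝ) ∈ Icc dl du from ⟨hdl, h.trans hd.2⟩) h0
      have : 0 < fm / d := div_pos_of_neg_of_neg hneg hd0
      simp only [mem_Iio]; linarith
    · right; rintro x ⟨d, hd, rfl⟩
      have hd0 : d < 0 := by
        rcases lt_or_ge d 0 with h | h
        · exact h
        · exact absurd (show (0 : ℝ) ∈ Icc dl du from ⟨hdl, h.trans hd.2⟩) h0
      have : fm / d < 0 := div_neg_of_pos_of_neg hpos hd0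
      simp only [mem_Ioi]; linarith

/-- "The midpoint `m(X⁽ᵏ⁾)` is not contained in `X⁽ᵏ⁺¹⁾`" when `0 ∉ F'(X)` and `f(m) ≠ 0`
[cite: Moore1979, §5.2 Thm 5.5 (proof)]. -/
theorem not_mem_newtonSet (h0 : (0 : ℝ) ∉ Icc dl du) (hfm : fm ≠ 0) :
    m ∉ newtonSet m fm (Icc dl du) := by
  rcases newtonSet_subset_Iio_or_Ioi (m := m) h0 hfm with h | h
  · exact fun hm => lt_irrefl m (h hm)
  · exact fun hm => lt_irrefl m (h hm)

/-- **Halving**: with `m = (a + b)/2` the midpoint, `0 ∉ D` and `f(m) ≠ 0`, the next iterate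
`X ∩ N(X)` of (5.16) lies in one half of `X`, so any two of its points are within `(b − a)/2`:
"`w(X⁽ᵏ⁺¹⁾) < ½ w(X⁽ᵏ⁾)`" [cite: Moore1979, §5.2 Thm 5.5 (proof)]. -/
theorem abs_sub_le_half_of_mem_inter_newtonSet {a b : ℝ} (h0 : (0 : ℝ) ∉ Icc dl du) (hfm : fm ≠ 0)
    {y z : ℝ} (hy : y ∈ Icc a b ∩ newtonSet ((a + b) / 2) fm (Icc dl du))
    (hz : z ∈ Icc a b ∩ newtonSet ((a + b) / 2) fm (Icc dl du)) : |y - z| ≤ (b - a) / 2 := by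
  rcases newtonSet_subset_Iio_or_Ioi (m := (a + b) / 2) h0 hfm with h | h
  · have hy' : y < (a + b) / 2 := h hy.2
    have hz' : z < (a + b) / 2 := h hz.2
    rw [abs_sub_le_iff]; constructor <;> linarith [hy.1.1, hz.1.1]
  · have hy' : (a + b) / 2 < y := h hy.2
    have hz' : (a + b) / 2 < z := h hz.2
    rw [abs_sub_le_iff]; constructor <;> linarith [hy.1.2, hz.1.2]

end Halving

/-! ### Worked instance: the first interval Newton step for `√2` on `[1, 2]` -/

section SqrtTwo

/-- Worked instance (this file's, not the book's): `f(x) = x² − 2`, `X = [1, 2]`, `m = 3/2`,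
`F'(X) = 2·X = [2, 4]` encloses `f' = 2x` on `X`; the Newton image (5.16) is `N(X) = [11/8, 23/16]`
[cite: Moore1979, §5.2 (5.16)]. -/
theorem sqrtTwo_newtonSet :
    newtonSet (3 / 2 : ℝ) ((3 / 2) ^ 2 - 2) (Icc 2 4) = Icc (11 / 8) (23 / 16) := by
  rw [newtonSet_Icc_of_pos_of_nonneg (by norm_num) (by norm_num) (by norm_num)]
  norm_num

/-- Worked instance of the test [cite: Moore1979, §5.2 Thm 5.5, Thm 5.6]: since
`N(X) = [11/8, 23/16] ⊆ X = [1, 2]` and `0 ∉ F'(X) = [2, 4]`, the equation `x² = 2` has exactly one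
solution in `[1, 2]`, and it lies in `[11/8, 23/16] = [1.375, 1.4375]` (the first step of (5.16)
towards `√2 = 1.41421…`). -/
theorem sqrtTwo_test :
    (∃! x : ℝ, x ∈ Icc 1 2 ∧ x ^ 2 - 2 = 0) ∧
      ∀ x ∈ Icc (1 : ℝ) 2, x ^ 2 - 2 = 0 → x ∈ Icc (11 / 8 : ℝ) (23 / 16) := by
  have hf : ∀ x ∈ Icc (1 : ℝ) 2, HasDerivAt (fun y : ℝ => y ^ 2 - 2) (2 * x) x := by
    intro x _
    have h := (hasDerivAt_pow 2 x).sub_const (2 : ℝ)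
    simpa using h
  have hD : ∀ x ∈ Icc (1 : ℝ) 2, 2 * x ∈ Icc (2 : ℝ) 4 := fun x hx =>
    ⟨by linarith [hx.1], by linarith [hx.2]⟩
  have h0 : (0 : ℝ) ∉ Icc (2 : ℝ) 4 := fun h => by linarith [h.1]
  have hm : (3 / 2 : ℝ) ∈ Icc (1 : ℝ) 2 := ⟨by norm_num, by norm_num⟩
  have hN : newtonSet (3 / 2 : ℝ) ((fun y : ℝ => y ^ 2 - 2) (3 / 2)) (Icc 2 4) ⊆ Icc 1 2 := by
    show newtonSet (3 / 2 : ℝ) ((3 / 2) ^ 2 - 2) (Icc 2 4) ⊆ Icc 1 2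
    rw [sqrtTwo_newtonSet]
    exact Icc_subset_Icc (by norm_num) (by norm_num)
  obtain ⟨huniq, hencl⟩ := existsUnique_zero_of_newtonSet_subset hf hD h0 hm hN
  refine ⟨huniq, fun x hx hx0 => ?_⟩
  have := hencl x hx hx0
  have e : newtonSet (3 / 2 : ℝ) ((fun y : ℝ => y ^ 2 - 2) (3 / 2)) (Icc 2 4) = Icc (11 / 8) (23 / 16) :=
    sqrtTwo_newtonSet
  rw [e] at this
  exact this

end SqrtTwo

end Literature.Analysis.ValidatedNumerics.IntervalNewton
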